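import Literature.AlgebraicGeometry.ProjectiveSpace.MonomialStarConfigurationSymbolicPowers
import HarnessLib

/-!
# The symbolic Rees algebra of a monomial star configuration is generated in degrees `1, …, c`:
# `I_c^{(k)} = ∑_{q=1}^{c} I_{c−q+1} · I_c^{(k−q)}`
# (Herzog–Hibi–Trung, Proposition 4.6; Carlini–Hà–Harbourne–Van Tuyl, Lemma 11.11 / Theorem 11.12)

Topic `Literature/AlgebraicGeometry/ProjectiveSpace`, namespace
`Literature.AlgebraicGeometry.ProjectiveSpace`. Lane `lit-hodgefound`, seat `lit-hodgefound-p32`,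
row gen31-#23. Theorems only (no `def`, no named fact). Sequel to gen31-#16/#17 (Lemma 11.11,
Theorem 11.12, Corollary 11.16, Theorem 11.14) in the same currency.

## The sources, as printed

J. Herzog, T. Hibi, N. V. Trung, *Symbolic powers of monomial ideals and vertex cover algebras*,
**Proposition 4.6.** "Let `Σ_n` denote the simplex of all subsets of `[n]`. Let `0 ≤ j ≤ n − 2`. Then
the minimal system of monomial generators of the `S`-algebra `A(Σ_n^{(j)})` consists of the monomials
`x_{i_1} x_{i_2} ⋯ x_{i_{n−j+q−1}} t^q`, where `1 ≤ q ≤ j + 1` and where `1 ≤ i_1 < i_2 < ⋯ <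
i_{n−j+q−1} ≤ n`." (The facets of the `j`-skeleton `Σ_n^{(j)}` are the `(j+1)`-subsets, so by Lemma
4.1 `A_k(Σ_n^{(j)}) = I_{j+1}^{(k)} t^k` with `I_c = ⋂_{|A| = c} (x_i : i ∈ A)` the monomial star
configuration of Carlini et al., **Definition 11.7**; its generators are the squarefree monomials of
degree `n − c + 1`, **Lemma 11.11**.) **Example 4.7** "The graph of a triangle is just the skeleton
`Σ_3^{(1)}`. Its vertex cover algebra … is … generated by `x_1x_2t, x_1x_3t, x_2x_3t, x_1x_2x_3t^2`".

## What is here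

`s = |σ|` variables, `1 ≤ c ≤ s` (`c = j + 1`), any field; `I_c`, `I_c^{(k)} = ⋂_{|A| = c} (x_A)^k`
as in gen31-#16. In ideal form Proposition 4.6 says that the symbolic Rees algebra `⊕_k I_c^{(k)} t^k`
is generated over `S` by `I_{c−q+1} t^q`, `q = 1, …, c` (the squarefree monomials of degree
`s − c + q` in degree `q`), i.e.

* § 1 the peeling step: if `x^a ∈ I_c^{(k)}` has support `B` (`|B| = s − c + q`, `1 ≤ q ≤ c` when
  `k ≥ 1`), then `x^{a − 𝟙_B} ∈ I_c^{(k−q)}` — an exchange argument on `c`-subsets;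
* § 2 products: `I_{c−q+1} · I_c^{(m)} ⊆ I_c^{(m+q)}`;
* § 3 **Proposition 4.6 (ideal form): `I_c^{(k)} = ∑_{q=1}^{c} I_{c−q+1} · I_c^{(k−q)}` for `k ≥ 1`**
  (truncated subtraction; the terms with `q > k` are `I_{c−q+1} ⊆ I_c^{(k)}`); Example 4.7.

## References

* [HerzogHibiTrung2007] J. Herzog, T. Hibi, N. V. Trung, *Symbolic powers of monomial ideals and
  vertex cover algebras*, Adv. Math. 210 (2007) 304–322, Prop. 4.6, Example 4.7, Lemma 4.1.
* [CarliniEtAl2020] E. Carlini, H. T. Hà, B. Harbourne, A. Van Tuyl, *Ideals of Powers and Powers of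
  Ideals*, LN UMI 27, Springer 2020, Def. 11.7, Lemma 11.11, Thm. 11.12.
-/

noncomputable section

open Finset MvPolynomial
open Literature.RingTheory.MvPolynomial

universe u

namespace Literature.AlgebraicGeometry.ProjectiveSpace

variable {σ : Type*} [Fintype σ] [DecidableEq σ]
variable {k : Type u} [Field k]

/-! ### § 1 Peeling the support off a vertex cover of the `c`-subsets -/

omit [Fintype σ] in
/-- The indicator exponent of a finset. [cite: HerzogHibiTrung2007, §4 ("`a_C`")] -/
private theorem sum_single_apply (B : Finset σ) (j : σ) :
    (∑ i ∈ B, Finsupp.single i 1 : σ →₀ ℕ) j = if j ∈ B then 1 else 0 := by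
  rw [Finsupp.finsetSum_apply]
  simp only [Finsupp.single_apply]
  rw [Finset.sum_ite_eq']

/-- **The exchange inequality**: if `∑_{i ∈ A} a_i ≥ k` for all `c`-subsets `A` and `B = supp a` with
`|B| + c ≥ s`, then `∑_{i ∈ A} a_i + (|B| + c − s) ≥ k + |A ∩ B|` for every `c`-subset `A` (trade
the surplus elements of `A ∩ B` for the zeros outside `B`).
[cite: HerzogHibiTrung2007, Prop. 4.6 (proof); CarliniEtAl2020, Thm. 11.12] -/
theorem sum_add_ge_of_cover {c k : ℕ} {a : σ →₀ ℕ}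
    (ha : ∀ A : Finset σ, A.card = c → k ≤ ∑ i ∈ A, a i)
    (hBc : Fintype.card σ ≤ a.support.card + c) {A : Finset σ} (hA : A.card = c) :
    k + (A ∩ a.support).card ≤ ∑ i ∈ A, a i + (a.support.card + c - Fintype.card σ) := by
  -- `t = |A ∩ B| ≥ q := |B| + c − s`
  have hunion := Finset.card_union_add_card_inter A a.support
  have huniv := Finset.card_le_univ (A ∪ a.support)
  have hBle := Finset.card_le_univ a.support
  have htq : a.support.card + c - Fintype.card σ ≤ (A ∩ a.support).card := by omega
  -- drop `t − q` elements of `A ∩ B` and add all of `Bᶜ`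
  obtain ⟨D, hDsub, hDcard⟩ := Finset.exists_subset_card_eq
    (show (A ∩ a.support).card - (a.support.card + c - Fintype.card σ) ≤ (A ∩ a.support).card by omega)
  have hdisj : Disjoint ((A ∩ a.support) \ D) a.supportᶜ := by
    rw [Finset.disjoint_left]
    intro i hi hi'
    exact Finset.mem_compl.mp hi' (Finset.mem_inter.mp (Finset.mem_sdiff.mp hi).1).2
  have hDle : D.card ≤ (A ∩ a.support).card := hDcard ▸ Nat.sub_le _ _
  have hA₀card : (((A ∩ a.support) \ D) ∪ a.supportᶜ).card = c := by
    have h1 : (((A ∩ a.support) \ D) ∪ a.supportᶜ).card =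
        ((A ∩ a.support).card - D.card) + (Fintype.card σ - a.support.card) := by
      rw [Finset.card_union_of_disjoint hdisj, Finset.card_sdiff_of_subset hDsub, Finset.card_compl]
    rw [h1, hDcard]
    omega
  have hA₀sum : ∑ i ∈ ((A ∩ a.support) \ D) ∪ a.supportᶜ, a i = ∑ i ∈ (A ∩ a.support) \ D, a i := by
    rw [Finset.sum_union hdisj]
    have hzero : ∑ i ∈ a.supportᶜ, a i = 0 :=
      Finset.sum_eq_zero fun i hi => Finsupp.notMem_support_iff.mp (Finset.mem_compl.mp hi)
    rw [hzero, add_zero]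
  have hk := ha _ hA₀card
  rw [hA₀sum] at hk
  -- `∑_A a ≥ ∑_{(A ∩ B) \ D} a + |D|`
  have hsplit : ∑ i ∈ A ∩ a.support, a i = ∑ i ∈ (A ∩ a.support) \ D, a i + ∑ i ∈ D, a i := by
    rw [← Finset.sum_sdiff hDsub]
  have hD : D.card ≤ ∑ i ∈ D, a i := by
    rw [Finset.card_eq_sum_ones]
    exact Finset.sum_le_sum fun i hi =>
      Nat.one_le_iff_ne_zero.mpr (Finsupp.mem_support_iff.mp (Finset.mem_inter.mp (hDsub hi)).2)
  have hAB : ∑ i ∈ A ∩ a.support, a i ≤ ∑ i ∈ A, a i :=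
    Finset.sum_le_sum_of_subset_of_nonneg Finset.inter_subset_left fun _ _ _ => Nat.zero_le _
  omega

/-- **The peeling step: if `x^a ∈ I_c^{(k)}` with support `B`, then `a − 𝟙_B` is a vertex cover of the
`c`-subsets of order `k − (|B| + c − s)`.** [cite: HerzogHibiTrung2007, Prop. 4.6 (proof)] -/
theorem cover_sub_indicator_support {c k : ℕ} {a : σ →₀ ℕ}
    (ha : ∀ A : Finset σ, A.card = c → k ≤ ∑ i ∈ A, a i) (hBc : Fintype.card σ ≤ a.support.card + c) :
    ∀ A : Finset σ, A.card = c → k - (a.support.card + c - Fintype.card σ) ≤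
      ∑ i ∈ A, (a - ∑ j ∈ a.support, Finsupp.single j 1 : σ →₀ ℕ) i := by
  intro A hA
  have h := sum_add_ge_of_cover ha hBc hA
  have hle : ∀ i ∈ A, (∑ j ∈ a.support, Finsupp.single j 1 : σ →₀ ℕ) i ≤ a i := by
    intro i _
    rw [sum_single_apply]
    split_ifs with hi
    · exact Nat.one_le_iff_ne_zero.mpr (Finsupp.mem_support_iff.mp hi)
    · exact Nat.zero_le _
  simp only [Finsupp.tsub_apply]
  rw [Finset.sum_tsub_distrib A hle]
  have hind : ∑ i ∈ A, (∑ j ∈ a.support, Finsupp.single j 1 : σ →₀ ℕ) i = (A ∩ a.support).card := by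
    simp_rw [sum_single_apply]
    rw [Finset.sum_boole, Finset.filter_mem_eq_inter, Nat.cast_id]
  rw [hind]
  omega

/-! ### § 2 `I_{c−q+1} · I_c^{(m)} ⊆ I_c^{(m+q)}` -/

omit [Fintype σ] [DecidableEq σ] in
/-- A monomial of `I_{c−q+1}` (`x^u` meeting every `(c−q+1)`-subset) has weight `≥ q` on every
`c`-subset. [cite: HerzogHibiTrung2007, Prop. 4.6; CarliniEtAl2020, Lemma 11.11] -/
theorem le_sum_of_meets_card_sub {c q : ℕ} (hqc : q ≤ c) {u : σ →₀ ℕ}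
    (hu : ∀ A' : Finset σ, A'.card = c - q + 1 → 1 ≤ ∑ i ∈ A', u i) {A : Finset σ} (hA : A.card = c) :
    q ≤ ∑ i ∈ A, u i := by
  classical
  -- the zeros of `u` inside `A` number at most `c − q`
  have hZle : (A.filter (fun i => u i = 0)).card ≤ c - q := by
    by_contra hlt
    push Not at hlt
    obtain ⟨A', hA'sub, hA'card⟩ := Finset.exists_subset_card_eq
      (show c - q + 1 ≤ (A.filter (fun i => u i = 0)).card by omega)
    have h1 := hu A' hA'card
    have h0 : ∑ i ∈ A', u i = 0 :=
      Finset.sum_eq_zero fun i hi => (Finset.mem_filter.mp (hA'sub hi)).2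
    omega
  -- the others contribute at least `1` each
  have hsum : (A.filter (fun i => ¬ u i = 0)).card ≤ ∑ i ∈ A, u i := by
    rw [Finset.card_eq_sum_ones, Finset.sum_filter]
    exact Finset.sum_le_sum fun i _ => by
      split_ifs with h
      · exact Nat.zero_le _
      · exact Nat.one_le_iff_ne_zero.mpr h
  have hpart := Finset.card_filter_add_card_filter_not (s := A) (fun i => u i = 0)
  rw [hA] at hpart
  omega

omit [Fintype σ] in
/-- **`I_{c−q+1} · I_c^{(m)} ⊆ I_c^{(m+q)}`** for `q ≤ c` (products of generators, termwise).
[cite: HerzogHibiTrung2007, Prop. 4.6 and Lemma 4.1 ("`A_k A_ℓ ⊂ A_{k+ℓ}`")] -/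
theorem starConfiguration_pred_mul_symbolic_le {c q : ℕ} (hqc : q ≤ c) (m : ℕ) :
    (⨅ A ∈ {A : Finset σ | A.card = c - q + 1}, Ideal.span ((X : σ → MvPolynomial σ k) '' (↑A : Set σ))) *
        (⨅ A ∈ {A : Finset σ | A.card = c}, (Ideal.span ((X : σ → MvPolynomial σ k) '' (↑A : Set σ))) ^ m) ≤
      ⨅ A ∈ {A : Finset σ | A.card = c}, (Ideal.span ((X : σ → MvPolynomial σ k) '' (↑A : Set σ))) ^ (m + q) := by
  classical
  rw [Ideal.mul_le]
  intro f hf g hg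
  rw [f.as_sum, g.as_sum, Finset.sum_mul_sum]
  refine Ideal.sum_mem _ fun u hu => Ideal.sum_mem _ fun v hv => ?_
  have huterm : (monomial u (1 : k) : MvPolynomial σ k) ∈ (⨅ A ∈ {A : Finset σ | A.card = c - q + 1},
      Ideal.span ((X : σ → MvPolynomial σ k) '' (↑A : Set σ))) := by
    rw [starConfiguration_eq_symbolic_one] at hf ⊢
    exact monomial_mem_starConfiguration_symbolic_of_mem_support _ 1 f hf u hu
  rw [starConfiguration_eq_symbolic_one, monomial_mem_starConfiguration_symbolic_iff] at huterm
  have hvterm := (monomial_mem_starConfiguration_symbolic_iff c m v).mp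
    (monomial_mem_starConfiguration_symbolic_of_mem_support c m g hg v hv)
  have hprod : monomial u (f.coeff u) * monomial v (g.coeff v) =
      C (f.coeff u * g.coeff v) * monomial (u + v) (1 : k) := by
    rw [monomial_mul, C_mul_monomial, mul_one]
  rw [hprod]
  refine Ideal.mul_mem_left _ _ ((monomial_mem_starConfiguration_symbolic_iff c (m + q) (u + v)).mpr ?_)
  intro A hA
  have h1 := le_sum_of_meets_card_sub hqc huterm hA
  have h2 := hvterm A hA
  simp only [Finsupp.coe_add, Pi.add_apply, Finset.sum_add_distrib]
  omega

/-! ### § 3 Proposition 4.6 in ideal form -/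

/-- **Proposition 4.6 (ideal form): for `c ≤ s` and `k ≥ 1`,
`I_c^{(k)} = ∑_{q=1}^{c} I_{c−q+1} · I_c^{(k−q)}`** — the symbolic Rees algebra of the monomial star
configuration `I_c` is generated over `S` by the squarefree monomials of degree `s − c + q` placed in
degree `q`, `q = 1, …, c`. [cite: HerzogHibiTrung2007, Prop. 4.6; CarliniEtAl2020, Lemma 11.11 and
Thm. 11.12] -/
theorem starConfiguration_symbolic_eq_biSup_mul {c n : ℕ} (hc : c ≤ Fintype.card σ) (hn : 1 ≤ n) :
    (⨅ A ∈ {A : Finset σ | A.card = c}, (Ideal.span ((X : σ → MvPolynomial σ k) '' (↑A : Set σ))) ^ n) =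
      ⨆ q ∈ Finset.Icc 1 c,
        (⨅ A ∈ {A : Finset σ | A.card = c - q + 1}, Ideal.span ((X : σ → MvPolynomial σ k) '' (↑A : Set σ))) *
          (⨅ A ∈ {A : Finset σ | A.card = c}, (Ideal.span ((X : σ → MvPolynomial σ k) '' (↑A : Set σ))) ^ (n - q)) := by
  classical
  refine le_antisymm ?_ ?_
  · intro f hf
    rw [f.as_sum]
    refine Ideal.sum_mem _ fun a haf => ?_
    have hterm := monomial_mem_starConfiguration_symbolic_of_mem_support c n f hf a haf
    have hcov := (monomial_mem_starConfiguration_symbolic_iff c n a).mp hterm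
    -- the support `B` has `|B| ≥ s − c + 1`
    have h1 : (monomial a (1 : k) : MvPolynomial σ k) ∈ (⨅ A ∈ {A : Finset σ | A.card = c},
        Ideal.span ((X : σ → MvPolynomial σ k) '' (↑A : Set σ))) := by
      rw [starConfiguration_eq_symbolic_one, monomial_mem_starConfiguration_symbolic_iff]
      exact fun A hA => hn.trans (hcov A hA)
    rw [monomial_mem_starConfiguration_iff hc] at h1
    have hBle := Finset.card_le_univ a.support
    obtain ⟨q, hq⟩ : ∃ q, q = a.support.card + c - Fintype.card σ := ⟨_, rfl⟩
    have hq1 : 1 ≤ q := by omega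
    have hqc : q ≤ c := by omega
    -- `x^a = x_B · x^{a − 𝟙_B}` with `x_B ∈ I_{c−q+1}` and `x^{a − 𝟙_B} ∈ I_c^{(n−q)}`
    have hle : (∑ j ∈ a.support, Finsupp.single j 1 : σ →₀ ℕ) ≤ a := fun i => by
      rw [sum_single_apply]
      split_ifs with hi
      · exact Nat.one_le_iff_ne_zero.mpr (Finsupp.mem_support_iff.mp hi)
      · exact Nat.zero_le _
    have hsplit : monomial a (f.coeff a) = C (f.coeff a) *
        ((∏ i ∈ a.support, (X i : MvPolynomial σ k)) *
          monomial (a - ∑ j ∈ a.support, Finsupp.single j 1) (1 : k)) := by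
      rw [prod_X_eq_monomial_sum_single, monomial_mul, one_mul, add_tsub_cancel_of_le hle, C_mul_monomial,
        mul_one]
    rw [hsplit]
    refine Ideal.mul_mem_left _ _ ?_
    have hxB : (∏ i ∈ a.support, (X i : MvPolynomial σ k)) ∈ (⨅ A ∈ {A : Finset σ | A.card = c - q + 1},
        Ideal.span ((X : σ → MvPolynomial σ k) '' (↑A : Set σ))) := by
      rw [starConfiguration_eq_span_prod_X (by omega : c - q + 1 ≤ Fintype.card σ)]
      refine Ideal.subset_span ⟨a.support, ?_, rfl⟩
      change a.support.card = Fintype.card σ - (c - q + 1) + 1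
      omega
    have hrest : (monomial (a - ∑ j ∈ a.support, Finsupp.single j 1) (1 : k) : MvPolynomial σ k) ∈
        (⨅ A ∈ {A : Finset σ | A.card = c},
          (Ideal.span ((X : σ → MvPolynomial σ k) '' (↑A : Set σ))) ^ (n - q)) := by
      rw [monomial_mem_starConfiguration_symbolic_iff]
      have hcov' := cover_sub_indicator_support hcov (by omega)
      rw [← hq] at hcov'
      exact hcov'
    have hmem : (∏ i ∈ a.support, (X i : MvPolynomial σ k)) *
          monomial (a - ∑ j ∈ a.support, Finsupp.single j 1) (1 : k) ∈
        (⨅ A ∈ {A : Finset σ | A.card = c - q + 1}, Ideal.span ((X : σ → MvPolynomial σ k) '' (↑A : Set σ))) *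
          (⨅ A ∈ {A : Finset σ | A.card = c},
            (Ideal.span ((X : σ → MvPolynomial σ k) '' (↑A : Set σ))) ^ (n - q)) :=
      Ideal.mul_mem_mul hxB hrest
    exact Submodule.mem_iSup_of_mem q (Submodule.mem_iSup_of_mem (Finset.mem_Icc.mpr ⟨hq1, hqc⟩) hmem)
  · refine iSup₂_le fun q hq => ?_
    rw [Finset.mem_Icc] at hq
    refine (starConfiguration_pred_mul_symbolic_le hq.2 (n - q)).trans ?_
    -- `I_c^{(n − q + q)} ⊆ I_c^{(n)}` (equality unless `q > n`)
    refine iInf₂_mono fun A _ => Ideal.pow_le_pow_right (by omega)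

/-- **Example 4.7 / Corollary 11.16 again: for `c = 2` (the triangle when `s = 3`) and `n ≥ 1`,
`I_2^{(n)} = I_2 · I_2^{(n−1)} + (x_1 ⋯ x_s) · I_2^{(n−2)}`.**
[cite: HerzogHibiTrung2007, Example 4.7; CarliniEtAl2020, Example 11.15] -/
theorem starConfiguration_two_symbolic_recursion (h2 : 2 ≤ Fintype.card σ) {n : ℕ} (hn : 1 ≤ n) :
    (⨅ A ∈ {A : Finset σ | A.card = 2}, (Ideal.span ((X : σ → MvPolynomial σ k) '' (↑A : Set σ))) ^ n) =
      (⨅ A ∈ {A : Finset σ | A.card = 2}, Ideal.span ((X : σ → MvPolynomial σ k) '' (↑A : Set σ))) *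
          (⨅ A ∈ {A : Finset σ | A.card = 2}, (Ideal.span ((X : σ → MvPolynomial σ k) '' (↑A : Set σ))) ^ (n - 1)) ⊔
        Ideal.span {∏ i, (X i : MvPolynomial σ k)} *
          (⨅ A ∈ {A : Finset σ | A.card = 2}, (Ideal.span ((X : σ → MvPolynomial σ k) '' (↑A : Set σ))) ^ (n - 2)) := by
  haveI : Nonempty σ := Fintype.card_pos_iff.mp (by omega)
  rw [starConfiguration_symbolic_eq_biSup_mul h2 hn, ← starConfiguration_one_eq_span_prod_X]
  have hIcc : Finset.Icc 1 2 = {1, 2} := by decide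
  rw [hIcc, Finset.iSup_insert, Finset.iSup_singleton]

end Literature.AlgebraicGeometry.ProjectiveSpace
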